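import Mathlib.MeasureTheory.Measure.Haar.Unique
import Mathlib.MeasureTheory.Group.Integral
import Mathlib.Analysis.Calculus.Deriv.Comp
import Mathlib.Analysis.Calculus.Deriv.Mul
import Mathlib.Analysis.Calculus.Deriv.Add
import Literature.Geometry.MetricEmbeddings.HeisenbergDiscretization
import HarnessLib

/-!
# From Naor–Young's `L₄` inequality on `ℍ³` as printed (Foliated corona decompositions, Thm. 1.1) to
the Cheeger–Kleiner–Naor bound on the `L₁`-distortion of Heisenberg word balls

Family `pnp`, layer `Literature/Geometry/MetricEmbeddings` (theorems only). Source, verbatim: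
A. Naor, R. Young, *Foliated corona decompositions*, Acta Math. 229 (2022) 55–200 =
arXiv:2004.12522, §1 (arXiv p. 3): "For a smooth function `f : ℝ³ → ℝ` define `Xf, Yf : ℝ³ → ℝ`
by setting for `h = (x,y,z) ∈ ℝ³`, `Xf(h) ≝ ∂f/∂x(h) + ½ y ∂f/∂z(h)` and
`Yf(h) ≝ ∂f/∂y(h) − ½ x ∂f/∂z(h)`. (1.1) Also, for `t ∈ (0,∞)` define `D_v^t f : ℝ³ → ℝ` by setting
for `h = (x,y,z) ∈ ℝ³`, `D_v^t f(h) ≝ (f(x,y,z+t) − f(h))/√t`. (1.2) **Theorem 1.1.** Every compactly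
supported smooth function `f : ℝ³ → ℝ` satisfies
`(∫_0^∞ (∫_{ℝ³} |D_v^t f(h)| dh)^4 dt/t)^{1/4} ≲ ∫_{ℝ³} (|Xf(h)| + |Yf(h)|) dh.` (1.3)"; §1.1
(arXiv p. 4): "the group structure on `ℍ` is given by
`g h ≝ (x+χ, y+υ, z+ζ+½(xυ − yχ))` (1.10)"; and §1.1.1 (arXiv p. 5): "if every compactly supported
smooth function `f : ℝ³ → ℝ` satisfies the inequality (1.7) then by [NY18] and the reasoning in
[NY18] we have `c_{ℓ₁}(𝓑_n) ≳ (log n)^{1/p}`. Thus, `c_{ℓ₁}(𝓑_n) ≳ ⁴√(log n)`, since Theorem 1.1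
asserts that (1.7) holds for `p = 4`."

## What is proved

* `leftSobolevL4_of_NaorYoung2022` — the CHANGE OF MODEL: the inequality (1.3) as printed (both
  sides raised to the fourth power; the `dt`-integral a lower Lebesgue integral;
  `∂f/∂x(h) = Df(h)[(1,0,0)]` etc.) implies the same inequality in the matrix model of `ℍ(ℝ)` with the
  LEFT-invariant horizontal derivatives `Df[(1,0,0)]`, `Df[(0,1,x)]` and the vertical difference
  `f(h cᵗ) − f(h)`, `h cᵗ = (x,y,z+t)`: apply the printed inequality to `f = F ∘ Θ`, where
  `Θ(x,y,z) = (−x, −y, −z + xy/2)` is a volume-preserving involution of `ℝ³` (`measurePreserving_thetaR`;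
  the composition of the negation with the shear `z ↦ z + xy/2`), an anti-isomorphism from the law
  (1.10) onto the matrix law `(x,y,z)·(x',y',z') = (x+x',y+y',z+z'+xy')`, under which the printed
  fields `X, Y` (right-invariant for (1.10)) become MINUS the left-invariant matrix-model fields
  (`fderiv_comp_thetaR`, computed through derivatives along the coordinate lines,
  `fderiv_apply_eq_deriv_line`) and `f(x,y,z+t) = F((Θh) c⁻ᵗ)`; changes of variables `u = Θh` and
  `u ↦ u cᵗ` (both volume preserving) identify the two sides.
* `CheegerKleinerNaor2011_wordBall_l1Distortion.of_NaorYoung2022_theorem_1_1` — **[NY22, Thm. 1.1]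
  as printed implies the vendored [CKN, Cor. 1.2]** `CheegerKleinerNaor2011_wordBall_l1Distortion`
  (`HeisenbergL1.lean`), with `δ = 1/4`: the composition of the change of model, the discretization
  `partialSums_of_leftSobolevL4` ([NY18, Lemma 3.6], `HeisenbergDiscretization.lean`) and
  `CheegerKleinerNaor2011_wordBall_l1Distortion.of_partialSums` ([NY18, §1.3],
  `HeisenbergL1NaorYoung.lean`). This is the deduction asserted in [NY22, §1.1.1] quoted above; what
  is NOT proved in the tree is Theorem 1.1 itself ([NY22] §§2–6). The hypothesis is taken with both
  sides of (1.3) raised to the fourth power; `NaorYoung2022_powForm_of_rootForm` derives that from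
  the printed fourth-root form, and `…of_NaorYoung2022_theorem_1_1_rootForm` is the same corollary
  with the hypothesis in the printed form.

## References

* [NaorYoung2022] A. Naor, R. Young, Acta Math. 229 (2022) 55–200, §1 (1.1)–(1.3), Thm. 1.1, §1.1
  (1.10), §1.1.1 (arXiv:2004.12522 pp. 3–5).
* [NaorYoung2018] A. Naor, R. Young, Ann. of Math. 188 (2018), §3.2 Lemma 3.6.
* [CheegerKleinerNaor2011] J. Cheeger, B. Kleiner, A. Naor, Acta Math. 207 (2011), Cor. 1.2.
-/

noncomputable section

open Finset
open scoped ContDiff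

namespace Literature.Geometry.MetricEmbeddings

/-! ### The change of model -/

section Transfer

open _root_.MeasureTheory _root_.MeasureTheory.Measure

/-- The change of model `Θ(x,y,z) = (−x, −y, −z + xy/2)`, an anti-isomorphism from the group law
`(x,y,z)·(x',y',z') = (x+x', y+y', z+z'+½(xy'−yx'))` of [NY22, (1.10)] onto the matrix model
`(x,y,z)·(x',y',z') = (x+x',y+y',z+z'+xy')`, is an involution. [cite: NaorYoung2022, §1.1 (1.10)] -/
theorem thetaR_involutive (h : ℝ × ℝ × ℝ) :
    (fun w : ℝ × ℝ × ℝ => (-w.1, -w.2.1, -w.2.2 + w.1 * w.2.1 / 2))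
      ((fun w : ℝ × ℝ × ℝ => (-w.1, -w.2.1, -w.2.2 + w.1 * w.2.1 / 2)) h) = h := by
  obtain ⟨x, y, z⟩ := h
  simp only [Prod.mk.injEq]
  exact ⟨by ring, by ring, by ring⟩

/-- `Θ` is continuous. [cite: NaorYoung2022, §1.1 (1.10)] -/
theorem continuous_thetaR :
    Continuous fun w : ℝ × ℝ × ℝ => (-w.1, -w.2.1, -w.2.2 + w.1 * w.2.1 / 2) := by
  fun_prop

/-- `Θ` is smooth. [cite: NaorYoung2022, §1.1 (1.10)] -/
theorem contDiff_thetaR :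
    ContDiff ℝ ∞ fun w : ℝ × ℝ × ℝ => (-w.1, -w.2.1, -w.2.2 + w.1 * w.2.1 / 2) := by
  fun_prop

/-- **`Θ` preserves Lebesgue measure** (it is the composition of the negation `w ↦ −w`, which
preserves the additive Haar measure of `ℝ³`, with the shear `(x,y,z) ↦ (x, y, z + xy/2)`).
[cite: NaorYoung2022, §1.1 (1.10)] -/
theorem measurePreserving_thetaR :
    MeasurePreserving (fun w : ℝ × ℝ × ℝ => (-w.1, -w.2.1, -w.2.2 + w.1 * w.2.1 / 2))
      (volume : Measure (ℝ × ℝ × ℝ)) volume := by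
  -- the shear
  have hS : MeasurePreserving (fun w : ℝ × ℝ × ℝ => (w.1, w.2.1, w.2.2 + w.1 * w.2.1 / 2))
      (volume : Measure (ℝ × ℝ × ℝ)) volume := by
    have h2 : ∀ a : ℝ, MeasurePreserving (fun u : ℝ × ℝ => (u.1, u.2 + a * u.1 / 2))
        (volume : Measure (ℝ × ℝ)) volume := by
      intro a
      have := (MeasurePreserving.id (volume : Measure ℝ)).skew_product
        (g := fun b c => c + a * b / 2) (by fun_prop)
        (Filter.Eventually.of_forall fun b => map_add_right_eq_self volume (a * b / 2))
      rw [Measure.volume_eq_prod]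
      simpa using this
    have := (MeasurePreserving.id (volume : Measure ℝ)).skew_product
      (g := fun a (u : ℝ × ℝ) => (u.1, u.2 + a * u.1 / 2)) (by fun_prop)
      (Filter.Eventually.of_forall fun a => by
        have h := (h2 a).map_eq
        rw [Measure.volume_eq_prod] at h
        exact h)
    rw [Measure.volume_eq_prod, Measure.volume_eq_prod]
    simpa using this
  -- the negation, coordinatewise
  have hN : MeasurePreserving (fun w : ℝ × ℝ × ℝ => -w) (volume : Measure (ℝ × ℝ × ℝ)) volume := by
    have h1 := Measure.measurePreserving_neg (volume : Measure ℝ)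
    have h23 : MeasurePreserving (Prod.map Neg.neg Neg.neg) (volume : Measure (ℝ × ℝ)) volume := by
      rw [Measure.volume_eq_prod]
      exact h1.prod h1
    have h123 : MeasurePreserving (Prod.map Neg.neg (Prod.map Neg.neg Neg.neg))
        (volume : Measure (ℝ × ℝ × ℝ)) volume := by
      rw [Measure.volume_eq_prod]
      exact h1.prod h23
    have e : (fun w : ℝ × ℝ × ℝ => -w) = Prod.map Neg.neg (Prod.map Neg.neg Neg.neg) := by
      funext w
      rfl
    rw [e]
    exact h123
  have e : (fun w : ℝ × ℝ × ℝ => (-w.1, -w.2.1, -w.2.2 + w.1 * w.2.1 / 2)) =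
      (fun w : ℝ × ℝ × ℝ => (w.1, w.2.1, w.2.2 + w.1 * w.2.1 / 2)) ∘ (fun w : ℝ × ℝ × ℝ => -w) := by
    funext w
    obtain ⟨x, y, z⟩ := w
    simp only [Function.comp_apply, Prod.neg_mk, Prod.mk.injEq]
    exact ⟨trivial, trivial, by ring⟩
  rw [e]
  exact hS.comp hN

/-- Directional derivatives along lines: for `Φ` differentiable at `p`,
`DΦ(p)[v] = (d/ds) Φ(p + s v)|_{s=0}`. [folklore] -/
theorem fderiv_apply_eq_deriv_line {Φ : ℝ × ℝ × ℝ → ℝ} {p : ℝ × ℝ × ℝ}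
    (hΦ : DifferentiableAt ℝ Φ p) (v : ℝ × ℝ × ℝ) :
    fderiv ℝ Φ p v = deriv (fun s : ℝ => Φ (p + s • v)) 0 := by
  have hline : HasDerivAt (fun s : ℝ => p + s • v) v 0 := by
    have h := ((hasDerivAt_id (0 : ℝ)).smul_const v).const_add p
    simpa using h
  have hcomp := hΦ.hasFDerivAt.comp_hasDerivAt_of_eq (0 : ℝ) hline (by simp)
  exact (hcomp.deriv).symm

/-- **The horizontal derivatives of `f = F ∘ Θ` in the printed model are the left-invariant
matrix-model derivatives of `F` at `Θ h`**: with `Xf(h) = ∂f/∂x + ½y ∂f/∂z`,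
`Yf(h) = ∂f/∂y − ½x ∂f/∂z` [NY22, (1.1)],
`Xf(h) = −DF(Θh)[(1,0,0)]` and `Yf(h) = −DF(Θh)[(0,1,(Θh)₁)]`
(`Θ(h + s e₁) = Θh + s(−1,0,y/2)`, `Θ(h + s e₂) = Θh + s(0,−1,x/2)`, `Θ(h + s e₃) = Θh − s e₃`).
[cite: NaorYoung2022, §1 (1.1) and §1.1 (1.10)] -/
theorem fderiv_comp_thetaR (F : ℝ × ℝ × ℝ → ℝ) (hF : Differentiable ℝ F) (h : ℝ × ℝ × ℝ) :
    (fderiv ℝ (F ∘ fun w : ℝ × ℝ × ℝ => (-w.1, -w.2.1, -w.2.2 + w.1 * w.2.1 / 2)) h (1, 0, 0) +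
        h.2.1 / 2 * fderiv ℝ (F ∘ fun w : ℝ × ℝ × ℝ => (-w.1, -w.2.1, -w.2.2 + w.1 * w.2.1 / 2)) h
          (0, 0, 1) = -fderiv ℝ F (-h.1, -h.2.1, -h.2.2 + h.1 * h.2.1 / 2) (1, 0, 0)) ∧
      (fderiv ℝ (F ∘ fun w : ℝ × ℝ × ℝ => (-w.1, -w.2.1, -w.2.2 + w.1 * w.2.1 / 2)) h (0, 1, 0) -
        h.1 / 2 * fderiv ℝ (F ∘ fun w : ℝ × ℝ × ℝ => (-w.1, -w.2.1, -w.2.2 + w.1 * w.2.1 / 2)) h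
          (0, 0, 1) = -fderiv ℝ F (-h.1, -h.2.1, -h.2.2 + h.1 * h.2.1 / 2) (0, 1, -h.1)) := by
  set Θ : ℝ × ℝ × ℝ → ℝ × ℝ × ℝ := fun w => (-w.1, -w.2.1, -w.2.2 + w.1 * w.2.1 / 2) with hΘdef
  have eΘ : ∀ w : ℝ × ℝ × ℝ, Θ w = (-w.1, -w.2.1, -w.2.2 + w.1 * w.2.1 / 2) := fun w => rfl
  rw [← eΘ h]
  have hΘd : Differentiable ℝ Θ := contDiff_thetaR.differentiable (by simp)
  have hfd : Differentiable ℝ (F ∘ Θ) := hF.comp hΘd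
  -- directional derivatives of `F ∘ Θ` along the coordinate lines
  have hdir : ∀ (e w : ℝ × ℝ × ℝ), (∀ s : ℝ, Θ (h + s • e) = Θ h + s • w) →
      fderiv ℝ (F ∘ Θ) h e = fderiv ℝ F (Θ h) w := by
    intro e w he
    rw [fderiv_apply_eq_deriv_line (hfd h) e, fderiv_apply_eq_deriv_line (hF (Θ h)) w]
    congr 1
    funext s
    simp only [Function.comp_apply, he s]
  obtain ⟨x, y, z⟩ := h
  have e1 : ∀ s : ℝ, Θ ((x, y, z) + s • ((1 : ℝ), (0 : ℝ), (0 : ℝ))) =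
      Θ (x, y, z) + s • ((-1 : ℝ), (0 : ℝ), y / 2) := by
    intro s
    refine Prod.ext ?_ (Prod.ext ?_ ?_) <;> simp <;> ring
  have e2 : ∀ s : ℝ, Θ ((x, y, z) + s • ((0 : ℝ), (1 : ℝ), (0 : ℝ))) =
      Θ (x, y, z) + s • ((0 : ℝ), (-1 : ℝ), x / 2) := by
    intro s
    refine Prod.ext ?_ (Prod.ext ?_ ?_) <;> simp <;> ring
  have e3 : ∀ s : ℝ, Θ ((x, y, z) + s • ((0 : ℝ), (0 : ℝ), (1 : ℝ))) =
      Θ (x, y, z) + s • ((0 : ℝ), (0 : ℝ), (-1 : ℝ)) := by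
    intro s
    refine Prod.ext ?_ (Prod.ext ?_ ?_) <;> simp <;> ring
  rw [hdir _ _ e1, hdir _ _ e2, hdir _ _ e3]
  constructor
  · rw [← smul_eq_mul, ← ContinuousLinearMap.map_smul, ← ContinuousLinearMap.map_add,
      ← ContinuousLinearMap.map_neg]
    congr 1
    refine Prod.ext ?_ (Prod.ext ?_ ?_) <;> simp
  · rw [← smul_eq_mul, ← ContinuousLinearMap.map_smul, ← ContinuousLinearMap.map_sub,
      ← ContinuousLinearMap.map_neg]
    congr 1
    refine Prod.ext ?_ (Prod.ext ?_ ?_) <;> simp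

/-- **From the printed form of [NY22, Thm. 1.1] to the left-invariant matrix-model form.** If every
compactly supported smooth `f : ℝ³ → ℝ` satisfies
`∫_0^∞ (∫ |D_v^t f(h)| dh)⁴ dt/t ≤ K⁴ (∫ (|Xf| + |Yf|) dh)⁴` with
`Xf = ∂_x f + ½ y ∂_z f`, `Yf = ∂_y f − ½ x ∂_z f`, `D_v^t f(h) = (f(x,y,z+t) − f(h))/√t`
[NY22, (1.1)–(1.3), Thm. 1.1, both sides raised to the fourth power], then every compactly supported
smooth `F` on the matrix model satisfies
`∫_0^∞ (∫ |F(u cᵗ) − F(u)| du)⁴ dt/t³ ≤ K⁴ (∫ (|DF[(1,0,0)]| + |DF[(0,1,u₁)]|) du)⁴`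
— apply the hypothesis to `f = F ∘ Θ` (`Θ` the volume-preserving anti-isomorphism above;
`fderiv_comp_thetaR`, and `∫|f(hcᵗ) − f(h)| dh = ∫ |F(u cᵗ) − F(u)| du` by the changes of variables
`u = Θh` and `u ↦ u cᵗ`). [cite: NaorYoung2022, Thm. 1.1 with (1.1)–(1.3), (1.10)] -/
theorem leftSobolevL4_of_NaorYoung2022 {K : ℝ}
    (H : ∀ f : ℝ × ℝ × ℝ → ℝ, ContDiff ℝ ∞ f → HasCompactSupport f →
      ∫⁻ t in Set.Ioi (0 : ℝ),
          ENNReal.ofReal ((∫ h, |(f (h.1, h.2.1, h.2.2 + t) - f h) / Real.sqrt t|) ^ 4 / t) ≤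
        ENNReal.ofReal ((K * ∫ h, (|fderiv ℝ f h (1, 0, 0) + h.2.1 / 2 * fderiv ℝ f h (0, 0, 1)| +
          |fderiv ℝ f h (0, 1, 0) - h.1 / 2 * fderiv ℝ f h (0, 0, 1)|)) ^ 4)) :
    ∀ F : ℝ × ℝ × ℝ → ℝ, ContDiff ℝ ∞ F → HasCompactSupport F →
      ∫⁻ t in Set.Ioi (0 : ℝ), ENNReal.ofReal ((∫ u, |F (u.1, u.2.1, u.2.2 + t) - F u|) ^ 4 / t ^ 3) ≤
        ENNReal.ofReal ((K * ∫ u, (|fderiv ℝ F u (1, 0, 0)| + |fderiv ℝ F u (0, 1, u.1)|)) ^ 4) := by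
  intro F hF hFc
  set Θ : ℝ × ℝ × ℝ → ℝ × ℝ × ℝ := fun w => (-w.1, -w.2.1, -w.2.2 + w.1 * w.2.1 / 2) with hΘ
  -- `Θ` as a homeomorphism (an involution)
  let ΘH : (ℝ × ℝ × ℝ) ≃ₜ (ℝ × ℝ × ℝ) :=
    { toFun := Θ, invFun := Θ, left_inv := thetaR_involutive, right_inv := thetaR_involutive,
      continuous_toFun := continuous_thetaR, continuous_invFun := continuous_thetaR }
  have hΘmp : MeasurePreserving Θ (volume : Measure (ℝ × ℝ × ℝ)) volume := measurePreserving_thetaR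
  have hΘemb : MeasurableEmbedding Θ := ΘH.measurableEmbedding
  -- the test function `f = F ∘ Θ`
  set f : ℝ × ℝ × ℝ → ℝ := F ∘ Θ with hf
  have hfs : ContDiff ℝ ∞ f := hF.comp contDiff_thetaR
  have hfc : HasCompactSupport f := hFc.comp_homeomorph ΘH
  have hH := H f hfs hfc
  -- the right-hand sides agree
  have hFd : Differentiable ℝ F := hF.differentiable (by simp)
  have hR : ∫ h : ℝ × ℝ × ℝ, (|fderiv ℝ f h (1, 0, 0) + h.2.1 / 2 * fderiv ℝ f h (0, 0, 1)| +
      |fderiv ℝ f h (0, 1, 0) - h.1 / 2 * fderiv ℝ f h (0, 0, 1)|) =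
      ∫ u : ℝ × ℝ × ℝ, (|fderiv ℝ F u (1, 0, 0)| + |fderiv ℝ F u (0, 1, u.1)|) := by
    have hpt : ∀ h : ℝ × ℝ × ℝ, (|fderiv ℝ f h (1, 0, 0) + h.2.1 / 2 * fderiv ℝ f h (0, 0, 1)| +
        |fderiv ℝ f h (0, 1, 0) - h.1 / 2 * fderiv ℝ f h (0, 0, 1)|) =
        (fun u : ℝ × ℝ × ℝ => |fderiv ℝ F u (1, 0, 0)| + |fderiv ℝ F u (0, 1, u.1)|) (Θ h) := by
      intro h
      obtain ⟨h1, h2⟩ := fderiv_comp_thetaR F hFd h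
      simp only [hf, hΘ]
      rw [h1, h2, abs_neg, abs_neg]
    calc ∫ h : ℝ × ℝ × ℝ, (|fderiv ℝ f h (1, 0, 0) + h.2.1 / 2 * fderiv ℝ f h (0, 0, 1)| +
          |fderiv ℝ f h (0, 1, 0) - h.1 / 2 * fderiv ℝ f h (0, 0, 1)|)
        = ∫ h : ℝ × ℝ × ℝ,
            (fun u : ℝ × ℝ × ℝ => |fderiv ℝ F u (1, 0, 0)| + |fderiv ℝ F u (0, 1, u.1)|) (Θ h) :=
          integral_congr_ae (Filter.Eventually.of_forall hpt)
      _ = ∫ u : ℝ × ℝ × ℝ,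
            (fun u : ℝ × ℝ × ℝ => |fderiv ℝ F u (1, 0, 0)| + |fderiv ℝ F u (0, 1, u.1)|) u :=
          hΘmp.integral_comp hΘemb
            (fun u : ℝ × ℝ × ℝ => |fderiv ℝ F u (1, 0, 0)| + |fderiv ℝ F u (0, 1, u.1)|)
      _ = _ := rfl
  -- the left-hand sides agree on `t > 0`
  have hL : ∀ t : ℝ, 0 < t →
      (∫ h : ℝ × ℝ × ℝ, |(f (h.1, h.2.1, h.2.2 + t) - f h) / Real.sqrt t|) ^ 4 / t =
        (∫ u : ℝ × ℝ × ℝ, |F (u.1, u.2.1, u.2.2 + t) - F u|) ^ 4 / t ^ 3 := by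
    intro t ht
    have hsq : 0 < Real.sqrt t := Real.sqrt_pos.mpr ht
    -- pull out `1/√t`
    have e1 : ∫ h : ℝ × ℝ × ℝ, |(f (h.1, h.2.1, h.2.2 + t) - f h) / Real.sqrt t| =
        (∫ h : ℝ × ℝ × ℝ, |f (h.1, h.2.1, h.2.2 + t) - f h|) / Real.sqrt t := by
      simp_rw [abs_div, abs_of_pos hsq]
      exact integral_div _ _
    -- change of variables `u = Θ h`, then `u ↦ u + (0,0,t)`
    have e2 : ∫ h : ℝ × ℝ × ℝ, |f (h.1, h.2.1, h.2.2 + t) - f h| =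
        ∫ u : ℝ × ℝ × ℝ, |F (u.1, u.2.1, u.2.2 + t) - F u| := by
      have hpt : ∀ h : ℝ × ℝ × ℝ, |f (h.1, h.2.1, h.2.2 + t) - f h| =
          (fun u : ℝ × ℝ × ℝ => |F (u.1, u.2.1, u.2.2 - t) - F u|) (Θ h) := by
        intro h
        obtain ⟨x, y, z⟩ := h
        simp only [hf, hΘ, Function.comp_apply]
        congr 2
        · congr 1
          simp only [Prod.mk.injEq]
          exact ⟨trivial, trivial, by ring⟩
      have hT : MeasurePreserving (⇑(MeasurableEquiv.addRight (((0 : ℝ), (0 : ℝ), t) : ℝ × ℝ × ℝ)))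
          (volume : Measure (ℝ × ℝ × ℝ)) volume := by
        have h0 := measurePreserving_add_right (volume : Measure ℝ) (0 : ℝ)
        have ht' := measurePreserving_add_right (volume : Measure ℝ) t
        have h := h0.prod (h0.prod ht')
        have e : (⇑(MeasurableEquiv.addRight (((0 : ℝ), (0 : ℝ), t) : ℝ × ℝ × ℝ))) =
            Prod.map (· + (0 : ℝ)) (Prod.map (· + (0 : ℝ)) (· + t)) := by
          funext u
          rfl
        rw [e, Measure.volume_eq_prod, Measure.volume_eq_prod]
        exact h
      have htr := hT.integral_comp' (fun u : ℝ × ℝ × ℝ => |F (u.1, u.2.1, u.2.2 - t) - F u|)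
      calc ∫ h : ℝ × ℝ × ℝ, |f (h.1, h.2.1, h.2.2 + t) - f h|
          = ∫ h : ℝ × ℝ × ℝ, (fun u : ℝ × ℝ × ℝ => |F (u.1, u.2.1, u.2.2 - t) - F u|) (Θ h) :=
            integral_congr_ae (Filter.Eventually.of_forall hpt)
        _ = ∫ u : ℝ × ℝ × ℝ, (fun u : ℝ × ℝ × ℝ => |F (u.1, u.2.1, u.2.2 - t) - F u|) u :=
            hΘmp.integral_comp hΘemb (fun u : ℝ × ℝ × ℝ => |F (u.1, u.2.1, u.2.2 - t) - F u|)
        _ = ∫ u : ℝ × ℝ × ℝ, (fun u : ℝ × ℝ × ℝ => |F (u.1, u.2.1, u.2.2 - t) - F u|)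
              ((MeasurableEquiv.addRight (((0 : ℝ), (0 : ℝ), t) : ℝ × ℝ × ℝ)) u) := htr.symm
        _ = ∫ u : ℝ × ℝ × ℝ, |F (u.1, u.2.1, u.2.2 + t) - F u| := by
            refine integral_congr_ae (Filter.Eventually.of_forall fun u => ?_)
            obtain ⟨a, b, c⟩ := u
            show |F (((a, b, c) + ((0 : ℝ), (0 : ℝ), t)).1, ((a, b, c) + ((0 : ℝ), (0 : ℝ), t)).2.1,
                ((a, b, c) + ((0 : ℝ), (0 : ℝ), t)).2.2 - t) - F ((a, b, c) + ((0 : ℝ), (0 : ℝ), t))| =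
              |F (a, b, c + t) - F (a, b, c)|
            simp only [Prod.mk_add_mk, add_zero, add_sub_cancel_right]
            exact abs_sub_comm _ _
    have hs4 : Real.sqrt t ^ 4 = t ^ 2 := by
      rw [show (4 : ℕ) = 2 * 2 from rfl, pow_mul, Real.sq_sqrt ht.le]
    rw [e1, e2, div_pow, hs4, div_div, ← pow_succ]
  -- rewrite both sides of the hypothesis
  have hL' : ∫⁻ t in Set.Ioi (0 : ℝ),
      ENNReal.ofReal ((∫ h, |(f (h.1, h.2.1, h.2.2 + t) - f h) / Real.sqrt t|) ^ 4 / t) =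
      ∫⁻ t in Set.Ioi (0 : ℝ), ENNReal.ofReal ((∫ u, |F (u.1, u.2.1, u.2.2 + t) - F u|) ^ 4 / t ^ 3) :=
    setLIntegral_congr_fun measurableSet_Ioi fun t ht => by rw [hL t ht]
  rw [hL', hR] at hH
  exact hH

/-- **The printed fourth-root form of [NY22, (1.3)] implies the fourth-power form** used above:
`(∫_0^∞ (∫|D_v^t f| dh)⁴ dt/t)^{1/4} ≤ K ∫ (|Xf| + |Yf|) dh` for all compactly supported smooth `f`
gives `∫_0^∞ (∫|D_v^t f| dh)⁴ dt/t ≤ (K ∫ (|Xf| + |Yf|) dh)⁴` (raise to the fourth power; the right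
side is nonnegative). [cite: NaorYoung2022, Thm. 1.1 (1.3)] -/
theorem NaorYoung2022_powForm_of_rootForm {K : ℝ} (hK : 0 ≤ K)
    (H : ∀ f : ℝ × ℝ × ℝ → ℝ, ContDiff ℝ ∞ f → HasCompactSupport f →
      (∫⁻ t in Set.Ioi (0 : ℝ),
          ENNReal.ofReal ((∫ h, |(f (h.1, h.2.1, h.2.2 + t) - f h) / Real.sqrt t|) ^ 4 / t)) ^
            (1 / 4 : ℝ) ≤
        ENNReal.ofReal (K * ∫ h, (|fderiv ℝ f h (1, 0, 0) + h.2.1 / 2 * fderiv ℝ f h (0, 0, 1)| +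
          |fderiv ℝ f h (0, 1, 0) - h.1 / 2 * fderiv ℝ f h (0, 0, 1)|))) :
    ∀ f : ℝ × ℝ × ℝ → ℝ, ContDiff ℝ ∞ f → HasCompactSupport f →
      ∫⁻ t in Set.Ioi (0 : ℝ),
          ENNReal.ofReal ((∫ h, |(f (h.1, h.2.1, h.2.2 + t) - f h) / Real.sqrt t|) ^ 4 / t) ≤
        ENNReal.ofReal ((K * ∫ h, (|fderiv ℝ f h (1, 0, 0) + h.2.1 / 2 * fderiv ℝ f h (0, 0, 1)| +
          |fderiv ℝ f h (0, 1, 0) - h.1 / 2 * fderiv ℝ f h (0, 0, 1)|)) ^ 4) := by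
  intro f hf hc
  have h := H f hf hc
  have hI : 0 ≤ K * ∫ h, (|fderiv ℝ f h (1, 0, 0) + h.2.1 / 2 * fderiv ℝ f h (0, 0, 1)| +
      |fderiv ℝ f h (0, 1, 0) - h.1 / 2 * fderiv ℝ f h (0, 0, 1)|) :=
    mul_nonneg hK (integral_nonneg fun h => by positivity)
  have h4 := ENNReal.rpow_le_rpow h (by norm_num : (0 : ℝ) ≤ 4)
  rw [← ENNReal.rpow_mul, show (1 / 4 : ℝ) * 4 = 1 by norm_num, ENNReal.rpow_one,
    ENNReal.ofReal_rpow_of_nonneg hI (by norm_num)] at h4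
  have e : (K * ∫ h, (|fderiv ℝ f h (1, 0, 0) + h.2.1 / 2 * fderiv ℝ f h (0, 0, 1)| +
      |fderiv ℝ f h (0, 1, 0) - h.1 / 2 * fderiv ℝ f h (0, 0, 1)|)) ^ (4 : ℝ) =
      (K * ∫ h, (|fderiv ℝ f h (1, 0, 0) + h.2.1 / 2 * fderiv ℝ f h (0, 0, 1)| +
        |fderiv ℝ f h (0, 1, 0) - h.1 / 2 * fderiv ℝ f h (0, 0, 1)|)) ^ (4 : ℕ) := by
    rw [← Real.rpow_natCast]
    norm_num
  rw [e] at h4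
  exact h4

end Transfer


/-- **Naor–Young [NY22, Thm. 1.1], as printed, implies the Cheeger–Kleiner–Naor bound
`CheegerKleinerNaor2011_wordBall_l1Distortion` ([CKN, Cor. 1.2] as vendored in `HeisenbergL1.lean`,
`c₁(𝔅_r, d_W) ≥ κ (log r)^δ`, here with `δ = 1/4`).** The hypothesis is Theorem 1.1 of [NY22]
transcribed on `ℝ × ℝ × ℝ`: for every compactly supported smooth `f : ℝ³ → ℝ`,
`∫_0^∞ (∫_{ℝ³} |D_v^t f(h)| dh)⁴ dt/t ≤ K⁴ (∫_{ℝ³} (|Xf(h)| + |Yf(h)|) dh)⁴` with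
`Xf(h) = ∂f/∂x(h) + ½ y ∂f/∂z(h)`, `Yf(h) = ∂f/∂y(h) − ½ x ∂f/∂z(h)`,
`D_v^t f(h) = (f(x,y,z+t) − f(h))/√t` ((1.1)–(1.3); "`≲`" = "`≤ K ·`" for a universal `K`, both sides
of (1.3) raised to the fourth power, the outer `dt`-integral as a lower Lebesgue integral, and
`∂f/∂x(h) = Df(h)[(1,0,0)]`, `∂f/∂y(h) = Df(h)[(0,1,0)]`, `∂f/∂z(h) = Df(h)[(0,0,1)]`). The proof is
the deduction of [NY22, §1.1.1] ("then by [NY18] and the reasoning in [NY18] we have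
`c_{ℓ₁}(𝓑_n) ≳ (log n)^{1/p}`"): change of model (`leftSobolevL4_of_NaorYoung2022`),
discretization [NY18, Lemma 3.6] (`partialSums_of_leftSobolevL4`), and the embedding argument
[NY18, §1.3] (`CheegerKleinerNaor2011_wordBall_l1Distortion.of_partialSums`).
[cite: NaorYoung2022, Thm. 1.1 with (1.1)–(1.3), and §1.1.1] [cite: NaorYoung2018, §3.2 Lemma 3.6, §1.3]
[cite: CheegerKleinerNaor2011, §1.1 Cor. 1.2] -/
theorem CheegerKleinerNaor2011_wordBall_l1Distortion.of_NaorYoung2022_theorem_1_1 {K : ℝ}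
    (hK : 0 ≤ K)
    (H : ∀ f : ℝ × ℝ × ℝ → ℝ, ContDiff ℝ ∞ f → HasCompactSupport f →
      ∫⁻ t in Set.Ioi (0 : ℝ),
          ENNReal.ofReal ((∫ h, |(f (h.1, h.2.1, h.2.2 + t) - f h) / Real.sqrt t|) ^ 4 / t) ≤
        ENNReal.ofReal ((K * ∫ h, (|fderiv ℝ f h (1, 0, 0) + h.2.1 / 2 * fderiv ℝ f h (0, 0, 1)| +
          |fderiv ℝ f h (0, 1, 0) - h.1 / 2 * fderiv ℝ f h (0, 0, 1)|)) ^ 4)) :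
    CheegerKleinerNaor2011_wordBall_l1Distortion :=
  CheegerKleinerNaor2011_wordBall_l1Distortion.of_leftSobolevL4 hK (leftSobolevL4_of_NaorYoung2022 H)

/-- **[NY22, Thm. 1.1] in its printed fourth-root form implies the Cheeger–Kleiner–Naor bound**:
if `(∫_0^∞ (∫_{ℝ³} |D_v^t f(h)| dh)⁴ dt/t)^{1/4} ≤ K ∫_{ℝ³} (|Xf(h)| + |Yf(h)|) dh` for every compactly
supported smooth `f : ℝ³ → ℝ` (display (1.3) with "`≲`" read as "`≤ K ·`"; `X, Y, D_v^t` as in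
(1.1)–(1.2); the `dt`-integral a lower Lebesgue integral), then
`CheegerKleinerNaor2011_wordBall_l1Distortion` holds (`NaorYoung2022_powForm_of_rootForm` and
`of_NaorYoung2022_theorem_1_1`). [cite: NaorYoung2022, Thm. 1.1 with (1.1)–(1.3), and §1.1.1] -/
theorem CheegerKleinerNaor2011_wordBall_l1Distortion.of_NaorYoung2022_theorem_1_1_rootForm {K : ℝ}
    (hK : 0 ≤ K)
    (H : ∀ f : ℝ × ℝ × ℝ → ℝ, ContDiff ℝ ∞ f → HasCompactSupport f →
      (∫⁻ t in Set.Ioi (0 : ℝ),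
          ENNReal.ofReal ((∫ h, |(f (h.1, h.2.1, h.2.2 + t) - f h) / Real.sqrt t|) ^ 4 / t)) ^
            (1 / 4 : ℝ) ≤
        ENNReal.ofReal (K * ∫ h, (|fderiv ℝ f h (1, 0, 0) + h.2.1 / 2 * fderiv ℝ f h (0, 0, 1)| +
          |fderiv ℝ f h (0, 1, 0) - h.1 / 2 * fderiv ℝ f h (0, 0, 1)|))) :
    CheegerKleinerNaor2011_wordBall_l1Distortion :=
  CheegerKleinerNaor2011_wordBall_l1Distortion.of_NaorYoung2022_theorem_1_1 hK
    (NaorYoung2022_powForm_of_rootForm hK H)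

end Literature.Geometry.MetricEmbeddings

end
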